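import Summits.QuantumFields.BalabanUV.Beta.FP.PackedLegBlocksAtSlices

/-!
# `BalabanUV.Beta.FP.PackedLegCombSym` — road «FP» for binder row D1, ROUTE T under RULING R-D1-g52-1 (β1) ∕ R-FP-71 ∕ R-FP-72: **THE SYM COMB LEG
# (S3-1)-G OF THE (0.4)-SYMMETRISED TOWER IN THE DOOR's BINDER SHAPES** — the four G-leg binders `hXG hLG hEAG hAEG` and the two (P2‴) lattice letters
# `hAG ∕ hAGsh` of #41d-Sym `TowerLawFullIndexSym` ∕ #42a-Sym `TowerKernelLawSym` (the OWNER d1-p3's INTENT I-FP-31-4 ∕ SPEC-44 ∕ SPEC-45 §B, worded to this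
# lineage: «the right inverse `XG` of `kkt ((perF M′ (bhKStepSh d Lc (Dsh Lc) (lev 0)))|ff) [Q₂₀; τ₂]` at the CENTRED comb, the UNSCALED sym step form —
# is that the sym comb leg your chart-(III′) letters can supply (`hXG hLG hEAG hAEG` with `A_G` = the sym top step's chart), or NOT THIS SHAPE?»),
# INHABITED BY NAME at `A_G := GcombSh Lc ℓ` (the chart of record (III′)), `ρ_G := ctr (d+1) Lc`, `L_G := Lc`, `f_G a := (pμ′ a, inr (mμ′ a))`,
# `X_G := (kkt …)⁻¹` — the sym twin of the OWNER's `PackedLegCombRooted` §2 (rooted chart `Π̂ᵀ(KInvStep Lc j)Π̂ @ r`, kernel `bhKStepAt`)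

WHY.  The (β1) re-based tower's door (#21-Sym ∕ #41c-Sym ∕ #41d-Sym ∕ #42a-Sym) reads the top step's `G` system as `kkt 𝓗|ff [Q₂₀; τ₂]` with
`𝓗 := perF M′ (bhKStepSh d Lc (Dsh Lc) (lev 0))` (UNSCALED — the unit `∏ (wVH)⁻¹` rides on the (S3-2) G blocks, #41d-G), `Q₂₀ := 𝓗.submatrix (pμ′, inr mμ′)
(fields)` in (B)'s slot presentation (`hfμ′ hcoarse′`), `τ₂ := combF Lc M′ (ctrOff (d+1) Lc)` — and DISPLAYS a right inverse `XG` (`hXG`), its packed leg over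
a chart kernel `A_G` under the torus rules (`hLG hEAG hAEG`, live indicator `axEc ρ_G L_G`, packing injection `f_G` with `hfG hmG hcG`) and, in #42a-Sym,
`A_G`'s decay and blocking-`Lc` covariance (`hAG hαG hAGsh`).  THIS IS EXACTLY leaf-05's chart-(III′) comb slice at level `ℓ := lev 0` on the box `M′`
(`PackedLegBlocksAtSlices` §2: kernel `bhKStepSh d Lc (Dsh Lc) ℓ`, rows `combRowsT (ctr (d+1) Lc) Lc M′`, chart `GcombSh Lc ℓ`, root `ctr (d+1) Lc`; the
LEVEL-0 precedent `LevelZeroLawFullIndex` discharged its F leg with the same three letters): `combF Lc M′ (ctrOff (d+1) Lc)` IS `(combRowsT (ctr (d+1) Lc) Lc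
M′).submatrix id (fields)` and `ctr (d+1) Lc` IS `toSite (ctrOff (d+1) Lc)` by `rfl` (§0), so
* §1 **`kkt_mul_inv_combSym`** = `hXG` at `X_G := (kkt …)⁻¹` (`PackedLegBlocksAtSlices.kkt_mul_inv_comb`, i.e. `Matrix.mul_nonsing_inv` + this lineage's
  `RelInvPeriodisedCombRecord.torus_isUnit_det_kkt_combRows_comb` — the same unit #21-Sym's `htop` uses);
* §2 **`packedLeg_combSym_eq`** = `hLG` VERBATIM at `A_G := GcombSh Lc ℓ`, `ρ_G := ctr (d+1) Lc`, `L_G := Lc`, `f_G a := (pμ′ a, inr (mμ′ a))`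
  (`PackedLegBlocksAtSlices.packedLeg_comb_eq`: #27 `packedLeg_kktInv` + the four comb block letters `RelInvPeriodisedCombMinOp ∕ …CombRecord`);
* §3 **`perF_rules_combSym`** = `hEAG ∧ hAEG` (`RelInvPeriodisedComb.perF_rules_comb` .1 ∕ .2.1) and **`lattice_letters_combSym`** = `(∃ C α, 0 < α ∧ Decays A_G C α)
  ∧ (∀ t, shiftK (Lc • t) A_G = A_G)` (an2 `CombChartStepJets.decays_GcombSh`, `RelInvPeriodisedComb.shiftK_GcombSh'`) — #42a-Sym's `hAG hαG hAGsh`;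
  the packing-injection letters `hfG := hfμ′`, `hmG := fun a => ⟨mμ′ a, rfl⟩`, `hcG := hcoarse′` are the slot presentation's own.
So the road's naming pass (R-FP-72 `TowerKernelLawNamed`) takes, per box `B`: `(hXG := kkt_mul_inv_combSym (M′ B) (hM′ B) (lev 0) (pμ′ B) (mμ′ B) (hfμ′ B)
(hcoarse′ B) (hQ₂₀ B) (hτ₂ B))`, `(hLG := packedLeg_combSym_eq …)`, `(ρG := ctr (d+1) Lc) (LGc := Lc) (fG := fun B a => (pμ′ B a, Sum.inr (mμ′ B a)))`,
`(hEAG := fun B => (perF_rules_combSym (M′ B) (hM′ B) (lev 0)).1)`, `(hAEG := … .2)`, `(hAGsh := (lattice_letters_combSym Lc (lev 0)).2)` after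
`obtain ⟨CAG, αG, hαG, hAG⟩ := (lattice_letters_combSym Lc (lev 0)).1`.  [folklore] one-line assemblies of LANDED letters BY NAME; no `def`, no `def … : Prop`,
nothing cited, 0 sorry; 0 estimates.  NOT HERE: the (S3-2) G blocks (`hVGm … hQG₂` — the row's (F2)-class item ∕ the de-periodisation), the N ∕ F legs
(an2's sym one-shot chart after K-U3d `psiKSym`; leaf-05 `PackedLegOneShotSockets` at the bare chart), any row of the door.

HONEST DEPENDENCY (page 1, mandatory): continuum YM on T⁴ ⇐ BetaPertH ∧ nine spine estimates (0/9 proved); BetaPertH ⇐ (D1) ∧ (D4) ∧ CAP+tail;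
G-an2-4 gates asym, D1 and NE2/3/4.  HONEST FRAMING (cell contract, verbatim): «discharging `BetaPertH` makes Bałaban's UV stability UNCONDITIONAL —
a real constructive-QFT result; it is NOT the continuum limit and NOT the Clay problem.»  ABSOLUTE RULE (cell charter, verbatim): «No internally-minted
statement may enter as a cited fact. Every hypothesis is either kernel-proved in this package or a verbatim quotation of a PUBLISHED theorem with page
reference. The manuscript(s) under audit are NOT citable for their own disputed steps — they are the thing under adjudication; programme-internal
(2001/route/tribunal) claims are never citable.»  Nothing of Bałaban's ∕ the dictionary's asserted ((β1) is the ROW's ruling, quoted); 0∕4 row-D1 binders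
(hW, hR, D1Tel, D1Rep); ROOT M‴ p325680 untouched; NOT (C1), NOT (T-ID), NOT SDF, NOT D1, NOT BetaPertH, NOT continuum, NOT Clay.
Provenance: D1 formalisation swarm, unit `b2b-balaban-beta-d1-formalise-leaf-05` gen 43, 2026-08-24, on the road «FP» OWNER's located ask (I-FP-31-4,
W-FP-32-3).  No existing file touched.
-/

noncomputable section

open scoped BigOperators Matrix

namespace Summit.QuantumFields.BalabanUV.Beta.FP.PackedLegCombSym

open Matrix
open Literature.Probability.LatticeModels (Torus.proj)
open Literature.MathematicalPhysics.QuantumFieldTheory.Balaban1983to89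
open Literature.MathematicalPhysics.QuantumFieldTheory.Balaban1983to89.Beta
open Literature.MathematicalPhysics.QuantumFieldTheory.Balaban1983to89.Beta.Composition (kkt)
open B6Lemma24Torus (pbox)
open ExpKernelCalculus (MKer Decays shiftK)
open AffineAveraging (Site box toSite)
open AveragingContoursRooted (ctr ctrOff)
open OneStepResolventKernel (Fib)
open Summit.QuantumFields.BalabanUV.Beta.AxialDressingRooted (axEc)
open Summit.QuantumFields.BalabanUV.Beta.SymShiftedSpread (bhKStepSh)
open Summit.QuantumFields.BalabanUV.Beta.DshAn1 (Dsh)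
open Summit.QuantumFields.BalabanUV.Beta.CombChartStepJets (GcombSh decays_GcombSh)
open Summit.QuantumFields.BalabanUV.Beta.FP.KernelPeriodisationFib (Idx perF)
open Summit.QuantumFields.BalabanUV.Beta.FP.TorusCombRows (Res combRowsT)
open Summit.QuantumFields.BalabanUV.Beta.FP.TorusCompositeObjects (combF)
open Summit.QuantumFields.BalabanUV.Beta.FP.PackedLegBlocksAtSlices (packedLeg_comb_eq kkt_mul_inv_comb)
open Summit.QuantumFields.BalabanUV.Beta.FP.RelInvPeriodisedComb (perF_rules_comb shiftK_GcombSh')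

variable {d : ℕ}

/-! ## §0 Two `rfl` letters: the door's comb slice `combF … (ctrOff …)` IS the (III′) record's `combRowsT (ctr …)` on the field slots -/

section Spelling

variable (Lc : ℕ) (M' : Fin (d + 1) → ℕ)

/-- [folklore] The centred root of the (β1) tower IS the (III′) record's root: `toSite (ctrOff (d+1) Lc) = ctr (d+1) Lc` (`AveragingContoursRooted.ctr`, `rfl`). -/
theorem toSite_ctrOff_eq_ctr : toSite (ctrOff (d + 1) Lc) = ctr (d + 1) Lc := rfl

/-- [folklore] The door's comb slice at the centred root IS the (III′) record's comb rows on the field slots: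
`combF Lc M′ (ctrOff (d+1) Lc) = (combRowsT (ctr (d+1) Lc) Lc M′).submatrix id (fields)` (`TorusCompositeObjects.combF`, `rfl`). -/
theorem combF_ctrOff_eq : combF Lc M' (ctrOff (d + 1) Lc)
    = (combRowsT (ctr (d + 1) Lc) Lc M').submatrix id (fun b : ↥(pbox M') × Fin (d + 1) => ((b.1, Sum.inl b.2) : Idx M' (Fib d))) := rfl

end Spelling

/-! ## §1 `hXG`: the right inverse of the UNSCALED sym comb-KKT, in (B)'s slot presentation -/

section Leg

variable {Lc : ℕ} [NeZero Lc] (M' : Fin (d + 1) → ℕ) [∀ μ, NeZero (M' μ)]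

set_option synthInstance.maxSize 1024 in
/-- [folklore] **`hXG` OF #41d-Sym ∕ #42a-Sym AT `X_G := (kkt 𝓗|ff [Q₂₀; τ₂])⁻¹`** — the top sym step's comb-KKT on the box `M′` (`Lc ∣ M′`), level `ℓ`
(the door's `lev 0`), averaging rows in (B)'s slot presentation, comb slice `combF Lc M′ (ctrOff (d+1) Lc)`: `kkt 𝓗|ff [Q₂₀; τ₂] * (kkt 𝓗|ff [Q₂₀; τ₂])⁻¹ = 1`
(`PackedLegBlocksAtSlices.kkt_mul_inv_comb` after §0). -/
theorem kkt_mul_inv_combSym (hM' : ∀ i, Lc ∣ M' i) (ℓ : ℕ)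
    {κ : Type*} [Fintype κ] [DecidableEq κ] (pμ' : κ → ↥(pbox M')) (mμ' : κ → Fin (d + 1))
    (hfμ' : Function.Injective (fun a : κ => ((pμ' a, Sum.inr (mμ' a)) : Idx M' (Fib d))))
    (hcoarse' : ∀ (s : ↥(pbox M')) (m : Fin (d + 1)),
      ((s, Sum.inr m) : Idx M' (Fib d)) ∈ Set.range (fun a : κ => ((pμ' a, Sum.inr (mμ' a)) : Idx M' (Fib d))) ↔ Torus.proj Lc (s : Site (d + 1)) = 0)
    {Q₂₀ : Matrix κ (↥(pbox M') × Fin (d + 1)) ℝ}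
    (hQ₂₀ : Q₂₀ = (perF M' (bhKStepSh d Lc (Dsh Lc) ℓ)).submatrix (fun a : κ => ((pμ' a, Sum.inr (mμ' a)) : Idx M' (Fib d)))
        (fun b : ↥(pbox M') × Fin (d + 1) => ((b.1, Sum.inl b.2) : Idx M' (Fib d))))
    {τ₂ : Matrix (Res (toSite (ctrOff (d + 1) Lc)) Lc M') (↥(pbox M') × Fin (d + 1)) ℝ} (hτ₂ : τ₂ = combF Lc M' (ctrOff (d + 1) Lc)) :
    kkt ((perF M' (bhKStepSh d Lc (Dsh Lc) ℓ)).submatrix (fun b : ↥(pbox M') × Fin (d + 1) => ((b.1, Sum.inl b.2) : Idx M' (Fib d)))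
          (fun b : ↥(pbox M') × Fin (d + 1) => ((b.1, Sum.inl b.2) : Idx M' (Fib d)))) (fromRows Q₂₀ τ₂)
      * (kkt ((perF M' (bhKStepSh d Lc (Dsh Lc) ℓ)).submatrix (fun b : ↥(pbox M') × Fin (d + 1) => ((b.1, Sum.inl b.2) : Idx M' (Fib d)))
          (fun b : ↥(pbox M') × Fin (d + 1) => ((b.1, Sum.inl b.2) : Idx M' (Fib d)))) (fromRows Q₂₀ τ₂))⁻¹ = 1 := by
  subst hQ₂₀ hτ₂
  exact kkt_mul_inv_comb M' hM' ℓ _ hfμ' (fun a => ⟨mμ' a, rfl⟩) hcoarse'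

/-! ## §2 `hLG`: the packed leg of `X_G` over `A_G := GcombSh Lc ℓ`, live indicator `axEc (ctr (d+1) Lc) Lc`, packing `f_G a := (pμ′ a, inr (mμ′ a))` -/

set_option synthInstance.maxSize 1024 in
/-- [folklore] **`hLG` OF #41d-Sym ∕ #42a-Sym, VERBATIM, AT `A_G := GcombSh Lc ℓ`, `ρ_G := ctr (d+1) Lc`, `L_G := Lc`, `f_G a := (pμ′ a, inr (mμ′ a))`,
`X_G := (kkt 𝓗|ff [Q₂₀; τ₂])⁻¹`**: `X_G.submatrix (Sum.map id inl) (Sum.map id inl) = fromBlocks Γ I L (−S)` with `Γ = of (Ê_bb · (Ê_b′b′ · Â_bb′))`,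
`I = of (Ê_bb · Â_{b, f_G a})`, `L = −of (Ê_bb · Â_{f_G a, b})`, `S = Â.submatrix f_G f_G`, `Â := perF M′ (GcombSh Lc ℓ)`, `Ê := perF M′ (axEc (ctr (d+1) Lc) Lc)` read
on the field diagonal (`PackedLegBlocksAtSlices.packedLeg_comb_eq` after §0). -/
theorem packedLeg_combSym_eq (hM' : ∀ i, Lc ∣ M' i) (ℓ : ℕ)
    {κ : Type*} [Fintype κ] [DecidableEq κ] (pμ' : κ → ↥(pbox M')) (mμ' : κ → Fin (d + 1))
    (hfμ' : Function.Injective (fun a : κ => ((pμ' a, Sum.inr (mμ' a)) : Idx M' (Fib d))))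
    (hcoarse' : ∀ (s : ↥(pbox M')) (m : Fin (d + 1)),
      ((s, Sum.inr m) : Idx M' (Fib d)) ∈ Set.range (fun a : κ => ((pμ' a, Sum.inr (mμ' a)) : Idx M' (Fib d))) ↔ Torus.proj Lc (s : Site (d + 1)) = 0)
    {Q₂₀ : Matrix κ (↥(pbox M') × Fin (d + 1)) ℝ}
    (hQ₂₀ : Q₂₀ = (perF M' (bhKStepSh d Lc (Dsh Lc) ℓ)).submatrix (fun a : κ => ((pμ' a, Sum.inr (mμ' a)) : Idx M' (Fib d)))
        (fun b : ↥(pbox M') × Fin (d + 1) => ((b.1, Sum.inl b.2) : Idx M' (Fib d))))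
    {τ₂ : Matrix (Res (toSite (ctrOff (d + 1) Lc)) Lc M') (↥(pbox M') × Fin (d + 1)) ℝ} (hτ₂ : τ₂ = combF Lc M' (ctrOff (d + 1) Lc)) :
    ((kkt ((perF M' (bhKStepSh d Lc (Dsh Lc) ℓ)).submatrix (fun b : ↥(pbox M') × Fin (d + 1) => ((b.1, Sum.inl b.2) : Idx M' (Fib d)))
          (fun b : ↥(pbox M') × Fin (d + 1) => ((b.1, Sum.inl b.2) : Idx M' (Fib d)))) (fromRows Q₂₀ τ₂))⁻¹).submatrix (Sum.map id Sum.inl) (Sum.map id Sum.inl)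
      = fromBlocks
          (Matrix.of fun (b b' : ↥(pbox M') × Fin (d + 1)) =>
            axEc (ctr (d + 1) Lc) Lc (b.1 : Site (d + 1)) (b.1 : Site (d + 1)) (Sum.inl b.2) (Sum.inl b.2)
              * (axEc (ctr (d + 1) Lc) Lc (b'.1 : Site (d + 1)) (b'.1 : Site (d + 1)) (Sum.inl b'.2) (Sum.inl b'.2)
                * perF M' (GcombSh (d := d) Lc ℓ) (b.1, Sum.inl b.2) (b'.1, Sum.inl b'.2)))
          (Matrix.of fun (b : ↥(pbox M') × Fin (d + 1)) (a : κ) =>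
            axEc (ctr (d + 1) Lc) Lc (b.1 : Site (d + 1)) (b.1 : Site (d + 1)) (Sum.inl b.2) (Sum.inl b.2)
              * perF M' (GcombSh (d := d) Lc ℓ) (b.1, Sum.inl b.2) ((pμ' a, Sum.inr (mμ' a)) : Idx M' (Fib d)))
          (-Matrix.of fun (a : κ) (b : ↥(pbox M') × Fin (d + 1)) =>
            axEc (ctr (d + 1) Lc) Lc (b.1 : Site (d + 1)) (b.1 : Site (d + 1)) (Sum.inl b.2) (Sum.inl b.2)
              * perF M' (GcombSh (d := d) Lc ℓ) ((pμ' a, Sum.inr (mμ' a)) : Idx M' (Fib d)) (b.1, Sum.inl b.2))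
          (-((perF M' (GcombSh (d := d) Lc ℓ)).submatrix (fun a : κ => ((pμ' a, Sum.inr (mμ' a)) : Idx M' (Fib d)))
              (fun a : κ => ((pμ' a, Sum.inr (mμ' a)) : Idx M' (Fib d))))) := by
  subst hQ₂₀ hτ₂
  exact packedLeg_comb_eq M' hM' ℓ _ hfμ' (fun a => ⟨mμ' a, rfl⟩) hcoarse'

/-! ## §3 `hEAG hAEG` (torus rules) and #42a-Sym's lattice letters `hAG hαG hAGsh` of `A_G := GcombSh Lc ℓ` -/

/-- [folklore] **`hEAG ∧ hAEG`**: `Ê·Â = Â` and `Â·Ê = Â` on every box with `Lc ∣ M′` (`RelInvPeriodisedComb.perF_rules_comb` .1 ∕ .2.1). -/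
theorem perF_rules_combSym (hM' : ∀ i, Lc ∣ M' i) (ℓ : ℕ) :
    perF M' (axEc (ctr (d + 1) Lc) Lc) * perF M' (GcombSh (d := d) Lc ℓ) = perF M' (GcombSh (d := d) Lc ℓ)
      ∧ perF M' (GcombSh (d := d) Lc ℓ) * perF M' (axEc (ctr (d + 1) Lc) Lc) = perF M' (GcombSh (d := d) Lc ℓ) :=
  ⟨(perF_rules_comb M' hM' ℓ).1, (perF_rules_comb M' hM' ℓ).2.1⟩

end Leg

section Lattice

variable (Lc : ℕ) [NeZero Lc]

/-- [folklore] **#42a-Sym's `hAG hαG hAGsh` FOR `A_G := GcombSh Lc ℓ`** (box-free): the comb-chart resolvent decays (an2 `CombChartStepJets.decays_GcombSh`,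
∃-packaged as `⟨C, α, 0 < α, Decays⟩`) and is blocking-`Lc` covariant (`RelInvPeriodisedComb.shiftK_GcombSh'`). -/
theorem lattice_letters_combSym (ℓ : ℕ) :
    (∃ C α : ℝ, 0 < α ∧ Decays (GcombSh (d := d) Lc ℓ) C α)
      ∧ ∀ t : Fin (d + 1) → ℤ, shiftK ((Lc : ℤ) • t) (GcombSh (d := d) Lc ℓ) = GcombSh (d := d) Lc ℓ := by
  obtain ⟨δ, C, hδ, -, hA⟩ := decays_GcombSh (d := d) Lc ℓ
  exact ⟨⟨C, δ, hδ, hA⟩, fun t => shiftK_GcombSh' (d := d) ℓ t⟩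

end Lattice

end Summit.QuantumFields.BalabanUV.Beta.FP.PackedLegCombSym

end
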